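import Summits.KontsevichZagierPeriods.KontsevichZagierPeriods.Theorems.HermiteRigidityGenusTwoCycleTransferPushforwardDimOne
import Summits.KontsevichZagierPeriods.KontsevichZagierPeriods.Theorems.HermiteRigidityGenusTwoCycleTransferSemialgebraicInvFunOn

/-!
# Transport of a one-dimensional representation along the two REAL sheets of a correspondence
(support of stmt-KontsevichZagierPeriods-14654 `JLPairIdentityOne`, route IsogenyCertificates;
reusable)

The real-sheet step of the KZ-derivation of `JLPairIdentityOne` (work report §6, §8, stub S2): on a
piece `σ` of the `C`-side domain where the two fibre points of the explicit correspondence are real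
and the sheet functions `φ₁, φ₂` are injective with nowhere-zero derivative, the trace identity
(`trace_identity_div` of `IsogenyCertificatesJLPairIdentityOneCorrespondence`, or its degree-18
analogue) writes the integrand as `c₁·F(φ₁)|φ₁′| + c₂·F(φ₂)|φ₂′|` (`F = 1/√f_X`, `cᵢ = ±1`).
`twoSheetTransport` turns this pointwise identity into moves: ONE integrand-additivity move (rule
1b) and TWO changes of variables (rule 2, the tree's `stub_pushforwardDimOne` with the semialgebraic
inverse `stub_semialgebraicInvFunOn`) produce representations `s₁, s₂` on the images `φᵢ(σ)` with
integrands `cᵢ·F` and `[r] − [s₁] − [s₂] ∈ KZ.relations`. All hypotheses are semialgebraicity /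
integrability / calculus facts about the sheet functions on `σ`; nothing specific to the curves.

References: M. Kontsevich, D. Zagier, *Periods* (2001), §1.2 rules (1), (2).
-/

noncomputable section

open Set MeasureTheory
open Literature.NumberTheory.Transcendental Literature.ModelTheory.ExponentialFields
open Summit.KontsevichZagierPeriods.HermiteRigidity.GenusTwoCycleTransfer
  (stub_pushforwardDimOne stub_semialgebraicInvFunOn)

namespace Summit.KontsevichZagierPeriods.IsogenyCertificates.TwoSheetTransport

/-- **One real sheet.** If on the domain `σ` of `r : KZ.IntegralRep 1` the integrand is
`c·F(φ(p 0))·|φ′(p 0)|` with `φ, φ′, F∘φ` `ℚ`-semialgebraic on `σ`, `φ′` the nowhere-zero derivative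
of `φ`, `φ` injective on `σ`, then the rule-2 push-forward along `φ` is a representation `s` on
`φ(σ)` with integrand `c·F` there and `[r] − [s] ∈ KZ.changeOfVariablesRel`.
[cite: KontsevichZagier2001, §1.2 rule (2)] -/
theorem oneSheet (r : KZ.IntegralRep 1) (F φ φ' : ℝ → ℝ) (c : ℚ)
    (hφ : IsSemialgebraicFunOn ℚ r.domain (fun p => φ (p 0)))
    (hφ' : IsSemialgebraicFunOn ℚ r.domain (fun p => φ' (p 0)))
    (hder : ∀ p ∈ r.domain, HasDerivAt φ (φ' (p 0)) (p 0))
    (hne : ∀ p ∈ r.domain, φ' (p 0) ≠ 0)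
    (hinj : ∀ p ∈ r.domain, ∀ q ∈ r.domain, φ (p 0) = φ (q 0) → p = q)
    (hr : ∀ p ∈ r.domain, r.integrand p = (c : ℝ) * F (φ (p 0)) * |φ' (p 0)|) :
    ∃ s : KZ.IntegralRep 1,
      s.domain = (fun p : Fin 1 → ℝ => fun _ : Fin 1 => φ (p 0)) '' r.domain ∧
      (∀ p ∈ r.domain, s.integrand (fun _ => φ (p 0)) = (c : ℝ) * F (φ (p 0))) ∧
      KZ.of r - KZ.of s ∈ KZ.changeOfVariablesRel := by
  set Φ : (Fin 1 → ℝ) → (Fin 1 → ℝ) := fun p _ => φ (p 0) with hΦ_def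
  have hσ : IsSemialgebraic ℚ r.domain := r.isSemialgebraic_domain
  have hΦsa : IsSemialgebraicMapOn ℚ r.domain Φ := IsSemialgebraicMapOn.of_forall hσ fun _ => hφ
  have hΦinj : InjOn Φ r.domain := fun p hp q hq h => hinj p hp q hq (congrFun h 0)
  have hG : IsSemialgebraicMapOn ℚ (Φ '' r.domain) (Function.invFunOn Φ r.domain) :=
    stub_semialgebraicInvFunOn hΦsa hΦinj
  have hGφ : ∀ p ∈ r.domain, Function.invFunOn Φ r.domain (fun _ => φ (p 0)) = p := fun p hp =>
    hΦinj.leftInvOn_invFunOn hp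
  obtain ⟨s, hsd, hsi, hrel⟩ := stub_pushforwardDimOne r φ φ' (Function.invFunOn Φ r.domain)
    hφ hφ' hder hne hG hGφ
  refine ⟨s, hsd, fun p hp => ?_, hrel⟩
  rw [hsi p hp, hr p hp, mul_div_assoc, div_self (abs_ne_zero.mpr (hne p hp)), mul_one]

/-- **Two real sheets** (stub S2 of the line proposed for `JLPairIdentityOne`, abstract form). If on
the domain `σ` of `r : KZ.IntegralRep 1` the integrand is `c₁·F(φ₁)|φ₁′| + c₂·F(φ₂)|φ₂′|` (the trace
identity of a (2,k)-correspondence on a piece with two real, injective, regular sheets `φ₁, φ₂`),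
and each sheet term is `ℚ`-semialgebraic and integrable on `σ`, then there are representations `s₁,
s₂` on the images `φᵢ(σ)` with integrands `cᵢ·F` and `[r] − [s₁] − [s₂] ∈ KZ.relations` (rule 1b
once, rule 2 twice). [cite: KontsevichZagier2001, §1.2 rules (1), (2)] -/
theorem twoSheetTransport (r : KZ.IntegralRep 1) (F φ₁ φ₁' φ₂ φ₂' : ℝ → ℝ) (c₁ c₂ : ℚ)
    (hφ₁ : IsSemialgebraicFunOn ℚ r.domain (fun p => φ₁ (p 0)))
    (hφ₁' : IsSemialgebraicFunOn ℚ r.domain (fun p => φ₁' (p 0)))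
    (hF₁ : IsSemialgebraicFunOn ℚ r.domain (fun p => F (φ₁ (p 0))))
    (hder₁ : ∀ p ∈ r.domain, HasDerivAt φ₁ (φ₁' (p 0)) (p 0))
    (hne₁ : ∀ p ∈ r.domain, φ₁' (p 0) ≠ 0)
    (hinj₁ : ∀ p ∈ r.domain, ∀ q ∈ r.domain, φ₁ (p 0) = φ₁ (q 0) → p = q)
    (hint₁ : IntegrableOn (fun p : Fin 1 → ℝ => F (φ₁ (p 0)) * |φ₁' (p 0)|) r.domain)
    (hφ₂ : IsSemialgebraicFunOn ℚ r.domain (fun p => φ₂ (p 0)))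
    (hφ₂' : IsSemialgebraicFunOn ℚ r.domain (fun p => φ₂' (p 0)))
    (hF₂ : IsSemialgebraicFunOn ℚ r.domain (fun p => F (φ₂ (p 0))))
    (hder₂ : ∀ p ∈ r.domain, HasDerivAt φ₂ (φ₂' (p 0)) (p 0))
    (hne₂ : ∀ p ∈ r.domain, φ₂' (p 0) ≠ 0)
    (hinj₂ : ∀ p ∈ r.domain, ∀ q ∈ r.domain, φ₂ (p 0) = φ₂ (q 0) → p = q)
    (hint₂ : IntegrableOn (fun p : Fin 1 → ℝ => F (φ₂ (p 0)) * |φ₂' (p 0)|) r.domain)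
    (htr : ∀ p ∈ r.domain, r.integrand p =
      (c₁ : ℝ) * F (φ₁ (p 0)) * |φ₁' (p 0)| + (c₂ : ℝ) * F (φ₂ (p 0)) * |φ₂' (p 0)|) :
    ∃ s₁ s₂ : KZ.IntegralRep 1,
      s₁.domain = (fun p : Fin 1 → ℝ => fun _ : Fin 1 => φ₁ (p 0)) '' r.domain ∧
      (∀ p ∈ r.domain, s₁.integrand (fun _ => φ₁ (p 0)) = (c₁ : ℝ) * F (φ₁ (p 0))) ∧
      s₂.domain = (fun p : Fin 1 → ℝ => fun _ : Fin 1 => φ₂ (p 0)) '' r.domain ∧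
      (∀ p ∈ r.domain, s₂.integrand (fun _ => φ₂ (p 0)) = (c₂ : ℝ) * F (φ₂ (p 0))) ∧
      KZ.of r - KZ.of s₁ - KZ.of s₂ ∈ KZ.relations := by
  have hσ : IsSemialgebraic ℚ r.domain := r.isSemialgebraic_domain
  -- the two sheet representations on σ
  have hsa₁ : IsSemialgebraicFunOn ℚ r.domain
      (fun p => (c₁ : ℝ) * F (φ₁ (p 0)) * |φ₁' (p 0)|) :=
    IsSemialgebraicFunOn.mul_holds (IsSemialgebraicFunOn.mul_holds
      (isSemialgebraicFunOn_const_ratCast hσ c₁) hF₁) hφ₁'.abs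
  have hsa₂ : IsSemialgebraicFunOn ℚ r.domain
      (fun p => (c₂ : ℝ) * F (φ₂ (p 0)) * |φ₂' (p 0)|) :=
    IsSemialgebraicFunOn.mul_holds (IsSemialgebraicFunOn.mul_holds
      (isSemialgebraicFunOn_const_ratCast hσ c₂) hF₂) hφ₂'.abs
  have hi₁ :
      IntegrableOn (fun p : Fin 1 → ℝ => (c₁ : ℝ) * F (φ₁ (p 0)) * |φ₁' (p 0)|) r.domain :=
    IntegrableOn.congr_fun (hint₁.const_mul (c₁ : ℝ)) (fun p _ => by ring)
      (KZ.IntegralRep.measurableSet_domain_holds r)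
  have hi₂ :
      IntegrableOn (fun p : Fin 1 → ℝ => (c₂ : ℝ) * F (φ₂ (p 0)) * |φ₂' (p 0)|) r.domain :=
    IntegrableOn.congr_fun (hint₂.const_mul (c₂ : ℝ)) (fun p _ => by ring)
      (KZ.IntegralRep.measurableSet_domain_holds r)
  let r₁ : KZ.IntegralRep 1 :=
    ⟨r.domain, fun p => (c₁ : ℝ) * F (φ₁ (p 0)) * |φ₁' (p 0)|, hσ, hsa₁, hi₁⟩
  let r₂ : KZ.IntegralRep 1 :=
    ⟨r.domain, fun p => (c₂ : ℝ) * F (φ₂ (p 0)) * |φ₂' (p 0)|, hσ, hsa₂, hi₂⟩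
  -- rule 1b
  have hadd : KZ.of r - KZ.of r₁ - KZ.of r₂ ∈ KZ.relations :=
    KZ.integrandAddRel_subset_relations ⟨1, r, r₁, r₂, rfl, rfl, fun p hp => htr p hp, rfl⟩
  -- rule 2 on each sheet
  obtain ⟨s₁, hd₁, hi₁', hrel₁⟩ :=
    oneSheet r₁ F φ₁ φ₁' c₁ hφ₁ hφ₁' hder₁ hne₁ hinj₁ (fun _ _ => rfl)
  obtain ⟨s₂, hd₂, hi₂', hrel₂⟩ :=
    oneSheet r₂ F φ₂ φ₂' c₂ hφ₂ hφ₂' hder₂ hne₂ hinj₂ (fun _ _ => rfl)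
  refine ⟨s₁, s₂, hd₁, hi₁', hd₂, hi₂', ?_⟩
  have key := KZ.relations.add_mem (KZ.relations.add_mem hadd
    (KZ.changeOfVariablesRel_subset_relations hrel₁))
    (KZ.changeOfVariablesRel_subset_relations hrel₂)
  convert key using 1
  abel

end Summit.KontsevichZagierPeriods.IsogenyCertificates.TwoSheetTransport

end
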